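import Summits.Ventures.PercRepro.ColumnSum
import Summits.Ventures.PercRepro.NearDominantHolds
import Summits.Ventures.PercRepro.MSTightTL

/-!
# The three-colour Marica–Schönheim statement when some type has at most one pair

`ColumnSum.lean` states the coloured Marica–Schönheim inequality `MSr r`: for a complement-closed
family `T` of configurations and an `r`-colouring `κ` with `κ Aᶜ ≠ κ A`,
`|T| ≤ 2 · |classDiffs T κ|`, where `classDiffs` is the union of the within-colour difference
families. `MS3 = MSr 3` is the set-theoretic core of the cell's C-005 line.

Fix a colour `i`. The pairs `{A, Aᶜ}` of `T` fall into three TYPES: those touching colour `i`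
with their other colour `j` or `k`, and those avoiding `i` (colours `{j, k}`). This file proves the
inequality whenever the type avoiding `i` has AT MOST ONE pair, under the hypothesis that the
colour-`i` class `C_i` has a down-closed difference family (transported to `Finset S` by p4's
indicator map `toFinset`): `msr3_card_le_of_small_type`.

Proof. `|T| = 2 |C_i| + |P|` with `P` the members of the small type. `classDiffs ⊇ C_i \\ C_i`, so
`|classDiffs| ≥ |C_i|` (Marica–Schönheim) and the case `P = ∅` is done. If `P = {u, uᶜ}` and
`|classDiffs| ≤ |C_i|`, then `classDiffs = C_i \\ C_i` and `C_i` is tight; every `t ∈ C_i` has its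
partner `tᶜ` of colour `κ u` or `κ uᶜ`, so the within-colour differences of `u` (resp. `uᶜ`) with
`tᶜ` put both agreement cells (resp. both disagreement cells) of `t` with respect to `u` into
`C_i \\ C_i`; the mixed-cell lemma `mem_or_sdiff_mem_of_tight_of_isDownSet` (MSTightTL) then gives
`u ∈ C_i` or `uᶜ ∈ C_i`, contradicting the colours. (Paper: proofs/MINE1-singlemerge.md §17.6;
the down-closed hypothesis is automatic in the map world and is removed on paper by Theorem S.)
-/

namespace PercRepro

open Finset
open scoped FinsetFamily

variable {S : Type} [Fintype S] [DecidableEq S]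

/-- The indicator map turns complements into complements in `univ`. -/
theorem toFinset_compl (A : Config S) : toFinset Aᶜ = Finset.univ \ toFinset A := by
  ext i
  simp only [mem_toFinset, Finset.mem_sdiff, Finset.mem_univ, true_and, Pi.compl_apply]
  cases A i <;> decide

/-- The indicator map commutes with meets. -/
theorem toFinset_inf (A B : Config S) : toFinset (A ⊓ B) = toFinset A ∩ toFinset B := by
  ext i
  simp only [mem_toFinset, Finset.mem_inter, Pi.inf_apply]
  cases A i <;> cases B i <;> decide

/-- The colour-`i` class of `T`. -/
def colourMembers (T : Finset (Config S)) {r : ℕ} (κ : Config S → Fin r) (i : Fin r) :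
    Finset (Config S) := T.filter fun A => κ A = i

/-- Members of `T` whose pair avoids colour `i`. -/
def avoidMembers (T : Finset (Config S)) {r : ℕ} (κ : Config S → Fin r) (i : Fin r) :
    Finset (Config S) := T.filter fun A => κ A ≠ i ∧ κ Aᶜ ≠ i

omit [DecidableEq S] in
/-- Membership in `classDiffs`: a within-colour difference. -/
theorem mem_classDiffs {r : ℕ} {T : Finset (Config S)} {κ : Config S → Fin r} {E : Config S} :
    E ∈ classDiffs T κ ↔ ∃ j : Fin r, E ∈ colourMembers T κ j \\ colourMembers T κ j := by
  unfold classDiffs colourMembers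
  simp only [Finset.mem_biUnion, Finset.mem_univ, true_and]

omit [DecidableEq S] in
/-- A difference of two members of the colour-`j` class lies in `classDiffs`. -/
theorem sdiff_mem_classDiffs {r : ℕ} {T : Finset (Config S)} {κ : Config S → Fin r} {A B : Config S}
    (hA : A ∈ T) (hB : B ∈ T) (hAB : κ A = κ B) : A \ B ∈ classDiffs T κ :=
  mem_classDiffs.2 ⟨κ A, Finset.mem_diffs.2 ⟨A, Finset.mem_filter.2 ⟨hA, rfl⟩, B,
    Finset.mem_filter.2 ⟨hB, hAB.symm⟩, rfl⟩⟩

omit [DecidableEq S] in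
/-- `T` is the disjoint union of the colour-`i` class, its complements, and the members whose pair
avoids `i`; hence `|T| = 2 |C_i| + |P|`. -/
theorem card_eq_two_mul_colourMembers_add {r : ℕ} (T : Finset (Config S)) (κ : Config S → Fin r)
    (hT : ∀ A ∈ T, Aᶜ ∈ T) (hκ : ∀ A ∈ T, κ Aᶜ ≠ κ A) (i : Fin r) :
    T.card = 2 * (colourMembers T κ i).card + (avoidMembers T κ i).card := by
  set C := colourMembers T κ i with hC
  set P := avoidMembers T κ i with hP
  -- the members whose complement has colour `i`
  set C' := T.filter fun A => κ Aᶜ = i with hC'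
  have hC'card : C'.card = C.card := by
    have : C' = C.image compl := by
      ext A
      simp only [hC', hC, colourMembers, Finset.mem_filter, Finset.mem_image]
      constructor
      · rintro ⟨hA, h⟩
        exact ⟨Aᶜ, ⟨hT A hA, h⟩, compl_compl A⟩
      · rintro ⟨B, ⟨hB, h⟩, rfl⟩
        exact ⟨hT B hB, by rw [compl_compl]; exact h⟩
    rw [this, Finset.card_image_of_injective _ compl_injective]
  have hdisj1 : Disjoint C C' := by
    rw [Finset.disjoint_left]
    intro A hA hA'
    simp only [hC, colourMembers, Finset.mem_filter] at hA
    simp only [hC', Finset.mem_filter] at hA'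
    exact hκ A hA.1 (hA'.2.trans hA.2.symm)
  have hdisj2 : Disjoint (C ∪ C') P := by
    rw [Finset.disjoint_left]
    intro A hA hAP
    simp only [hP, avoidMembers, Finset.mem_filter] at hAP
    rcases Finset.mem_union.1 hA with h | h
    · simp only [hC, colourMembers, Finset.mem_filter] at h
      exact hAP.2.1 h.2
    · simp only [hC', Finset.mem_filter] at h
      exact hAP.2.2 h.2
  have hunion : T = (C ∪ C') ∪ P := by
    ext A
    simp only [Finset.mem_union, hC, hC', hP, colourMembers, avoidMembers, Finset.mem_filter]
    constructor
    · intro hA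
      by_cases h1 : κ A = i
      · exact Or.inl (Or.inl ⟨hA, h1⟩)
      · by_cases h2 : κ Aᶜ = i
        · exact Or.inl (Or.inr ⟨hA, h2⟩)
        · exact Or.inr ⟨hA, h1, h2⟩
    · rintro ((⟨hA, _⟩ | ⟨hA, _⟩) | ⟨hA, _⟩) <;> exact hA
  rw [hunion, Finset.card_union_of_disjoint hdisj2, Finset.card_union_of_disjoint hdisj1, hC'card]
  ring

/-- **`MSr 3` when the type avoiding colour `i` has at most one pair**, under a down-closed
difference family of the colour-`i` class (transported by the indicator map). -/
theorem msr3_card_le_of_small_type (T : Finset (Config S)) (κ : Config S → Fin 3)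
    (hT : ∀ A ∈ T, Aᶜ ∈ T) (hκ : ∀ A ∈ T, κ Aᶜ ≠ κ A) (i : Fin 3)
    (hsmall : (avoidMembers T κ i).card ≤ 2)
    (hD : MSTight.IsDownSet ((colourMembers T κ i).image toFinset \\ (colourMembers T κ i).image toFinset)) :
    T.card ≤ 2 * (classDiffs T κ).card := by
  set C := colourMembers T κ i with hC
  set P := avoidMembers T κ i with hP
  have hcount := card_eq_two_mul_colourMembers_add T κ hT hκ i
  rw [← hC, ← hP] at hcount
  -- `C \\ C ⊆ classDiffs`
  have hsub : C \\ C ⊆ classDiffs T κ := by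
    intro E hE
    obtain ⟨A, hA, B, hB, rfl⟩ := Finset.mem_diffs.1 hE
    simp only [hC, colourMembers, Finset.mem_filter] at hA hB
    exact sdiff_mem_classDiffs hA.1 hB.1 (hA.2.trans hB.2.symm)
  have hMS : C.card ≤ (C \\ C).card := Finset.card_le_card_diffs C
  have hcd : C.card ≤ (classDiffs T κ).card := hMS.trans (Finset.card_le_card hsub)
  -- the small type is complement-closed; if nonempty it is a pair `{u, uᶜ}`
  by_cases hPe : P = ∅
  · rw [hPe, Finset.card_empty, add_zero] at hcount
    omega
  · obtain ⟨u, hu⟩ := Finset.nonempty_iff_ne_empty.2 hPe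
    have huP := hu
    simp only [hP, avoidMembers, Finset.mem_filter] at huP
    obtain ⟨huT, hui, huci⟩ := huP
    have hucP : uᶜ ∈ P := by
      simp only [hP, avoidMembers, Finset.mem_filter]
      exact ⟨hT u huT, huci, by rw [compl_compl]; exact hui⟩
    have hne : u ≠ uᶜ := by
      intro h
      exact hκ u huT (by rw [← h])
    have hP2 : P.card = 2 := by
      refine le_antisymm hsmall ?_
      have : ({u, uᶜ} : Finset (Config S)) ⊆ P := by
        intro A hA
        rcases Finset.mem_insert.1 hA with rfl | hA
        · exact hu
        · rw [Finset.mem_singleton.1 hA]; exact hucP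
      calc 2 = ({u, uᶜ} : Finset (Config S)).card := by rw [Finset.card_pair hne]
        _ ≤ P.card := Finset.card_le_card this
    -- every member of `P` is `u` or `uᶜ`
    have hPeq : P = {u, uᶜ} := by
      symm
      apply Finset.eq_of_subset_of_card_le
      · intro A hA
        rcases Finset.mem_insert.1 hA with rfl | hA
        · exact hu
        · rw [Finset.mem_singleton.1 hA]; exact hucP
      · rw [hP2, Finset.card_pair hne]
    rw [hP2] at hcount
    -- suppose the inequality fails: then `classDiffs = C \\ C` and `C` is tight
    by_contra hlt
    have hlt' : 2 * (classDiffs T κ).card < T.card := Nat.lt_of_not_le hlt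
    have hcd' : (classDiffs T κ).card ≤ C.card := by omega
    have hCD : C \\ C = classDiffs T κ :=
      Finset.eq_of_subset_of_card_le hsub (hcd'.trans hMS)
    have htight : (C \\ C).card = C.card := le_antisymm (hCD ▸ hcd') hMS
    -- transport to finsets
    set F := C.image toFinset with hF
    have hFtight : MSTight.Tight F := tight_image_toFinset htight
    have hFu : ∀ A ∈ F, A ⊆ Finset.univ := fun _ _ => Finset.subset_univ _
    have hFne : F.Nonempty := by
      -- `C` is nonempty: `u`'s partner `uᶜ` has colour `κ uᶜ ≠ i`... use instead the pair of `u`: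
      -- `T` contains a member of colour `i` unless every member avoids `i`; then `T = P` and
      -- `classDiffs ⊇ {u \ u} = {⊥}` gives `|T| = 2 ≤ 2 |classDiffs|`.
      by_contra hFe
      rw [Finset.not_nonempty_iff_eq_empty, hF, Finset.image_eq_empty] at hFe
      rw [hFe, Finset.card_empty] at hcount
      have hbot : (⊥ : Config S) ∈ classDiffs T κ := by
        have := sdiff_mem_classDiffs (κ := κ) huT huT rfl
        rwa [sdiff_self] at this
      have : 1 ≤ (classDiffs T κ).card := Finset.card_pos.2 ⟨⊥, hbot⟩
      omega
    -- transport of differences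
    have hdiff : ∀ E : Config S, E ∈ classDiffs T κ → toFinset E ∈ F \\ F := by
      intro E hE
      rw [← hCD] at hE
      rw [hF, ← image_toFinset_diffs]
      exact Finset.mem_image_of_mem _ hE
    -- the three colours are `i`, `κ u`, `κ uᶜ`
    have h3 : ∀ a b c d : Fin 3, a ≠ b → c ≠ b → d ≠ b → c ≠ d → a = c ∨ a = d := by decide
    -- the mixed-cell hypothesis for `w = toFinset u`
    have hcond : ∀ t ∈ F, (t ∩ toFinset u ∈ F \\ F ∧
        (Finset.univ \ t) ∩ (Finset.univ \ toFinset u) ∈ F \\ F) ∨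
        (t ∩ (Finset.univ \ toFinset u) ∈ F \\ F ∧ (Finset.univ \ t) ∩ toFinset u ∈ F \\ F) := by
      intro t ht
      obtain ⟨A, hA, rfl⟩ := Finset.mem_image.1 ht
      have hAC := hA
      simp only [hC, colourMembers, Finset.mem_filter] at hAC
      obtain ⟨hAT, hAi⟩ := hAC
      have hAcT : Aᶜ ∈ T := hT A hAT
      have hAc_ne : κ Aᶜ ≠ i := fun h => hκ A hAT (h.trans hAi.symm)
      rcases h3 (κ Aᶜ) i (κ u) (κ uᶜ) hAc_ne hui huci (fun h => hκ u huT h.symm) with hcol | hcol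
      · -- agreement cells: `u \ Aᶜ = u ⊓ A` and `Aᶜ \ u = Aᶜ ⊓ uᶜ`
        left
        have e1 : toFinset (u \ Aᶜ) = toFinset A ∩ toFinset u := by
          rw [toFinset_sdiff, toFinset_compl]
          ext s; simp only [Finset.mem_sdiff, Finset.mem_inter, Finset.mem_univ, true_and, not_not]
          exact and_comm
        have e2 : toFinset (Aᶜ \ u) = (Finset.univ \ toFinset A) ∩ (Finset.univ \ toFinset u) := by
          rw [toFinset_sdiff, toFinset_compl]
          ext s; simp only [Finset.mem_sdiff, Finset.mem_inter, Finset.mem_univ, true_and]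
        refine ⟨?_, ?_⟩
        · rw [← e1]; exact hdiff _ (sdiff_mem_classDiffs huT hAcT hcol.symm)
        · rw [← e2]; exact hdiff _ (sdiff_mem_classDiffs hAcT huT hcol)
      · -- disagreement cells: `uᶜ \ Aᶜ = A ⊓ uᶜ` and `Aᶜ \ uᶜ = Aᶜ ⊓ u`
        right
        have e1 : toFinset (uᶜ \ Aᶜ) = toFinset A ∩ (Finset.univ \ toFinset u) := by
          rw [toFinset_sdiff, toFinset_compl, toFinset_compl]
          ext s; simp only [Finset.mem_sdiff, Finset.mem_inter, Finset.mem_univ, true_and, not_not]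
          tauto
        have e2 : toFinset (Aᶜ \ uᶜ) = (Finset.univ \ toFinset A) ∩ toFinset u := by
          rw [toFinset_sdiff, toFinset_compl, toFinset_compl]
          ext s; simp only [Finset.mem_sdiff, Finset.mem_inter, Finset.mem_univ, true_and, not_not]
        have hucT : uᶜ ∈ T := hT u huT
        refine ⟨?_, ?_⟩
        · rw [← e1]; exact hdiff _ (sdiff_mem_classDiffs hucT hAcT hcol.symm)
        · rw [← e2]; exact hdiff _ (sdiff_mem_classDiffs hAcT hucT hcol)
    -- the mixed-cell lemma: `u` or `uᶜ` would have colour `i`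
    rcases MSTight.mem_or_sdiff_mem_of_tight_of_isDownSet hFtight hD hFu hFne
        (Finset.subset_univ _) hcond with hw | hw
    · obtain ⟨A, hA, hAu⟩ := Finset.mem_image.1 hw
      have := toFinset_injective hAu
      subst this
      simp only [hC, colourMembers, Finset.mem_filter] at hA
      exact hui hA.2
    · rw [← toFinset_compl] at hw
      obtain ⟨A, hA, hAu⟩ := Finset.mem_image.1 hw
      have := toFinset_injective hAu
      subst this
      simp only [hC, colourMembers, Finset.mem_filter] at hA
      exact huci hA.2

end PercRepro
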